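/-
Copyright (c) 2026 the pub-hodgecm-mathlib formalisation cell (harness21).  Prover seat hodgecm-mathlib-LH4-p07 (g8), req620 Track A «(D-RAM) FOUR-FRAME» squad
(STAGE-1b pre-scoping, heir LEAD F0P3a-plan (g20) T19-24 clause; dealer LH4-plan (g12) WORD #36 «p07 (g8): row-(2) lead»), 2026-09-04.
-/
import Summits.HodgeConjecture.HodgeConjecture.Theorems.F0P3cDyRamBlockGlueTokenCount         -- ★ (this seat): (C1-P^X) part 1, O-GLUE COUNT with a generic block token
import Summits.HodgeConjecture.HodgeConjecture.Theorems.F0P3cDyRamBlockCensusOrderFormLevel   -- ★ p858894 (this seat): brings ★ p858844 (W4₂, (C₂), φ-lemma), ★ (C1) p857559, ★ p857411, ★ per-cell norm fibre, ★ DEFS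
import HarnessLib

/-!
# Crux `H413`, line LH4 «(D-RAM) FOUR-FRAME» — STAGE-1b, row (2): organ (C1-P^X) part 2 «THE BLOCK CENSUS WITH A GENERIC BLOCK TOKEN, IN M-LETTERS»
# `#{M ∣ SD, Γ·M = M, X·M ⊆ cM} = Σ_{j ≤ J} [lam, (jE c)⁻¹ξ ∈ 𝒪_j]·#levelSet(j,0) + Σ_{b=1}^{R} Σ_{j ≤ J} [lam, (jE c)⁻¹ξ ∈ 𝒪_j]·Σᶠ_{Λ ∈ levelSetDep(j,b;μ) ∩ levelSetDep(j,b;μ_X)} #Sol_{2b}(r_Λ)`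

Cell `hodgecm-mathlib` (D-0151), FLOOR 0, crux item H413 = `stmt-HodgeConjecture-24833`, route of record `HCCMUnconditional`; squad F0∕P3c∕LH4; lane
`--supports stmt-HodgeConjecture-24833 --as helper` (count-neutral; pays NO tier-0 row).  THEOREMS ONLY (no `def`, no instance, no notation, no `sorry`).  DATUM-FREE
(abstract valued fields `E ⊂ M` exactly as ★ (C1) p857559).

WHAT THIS IS — ★ (C1) `ncard_fixed_selfDual_endoGL_eq_orderForm` WITH A GENERIC BLOCK TOKEN `X·M ⊆ c·M` (`X` block at `1` with compression `X_W` and middle entry `x₁₁ = X₁₁`;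
`c ≠ 0`, guard `|x₁₁| ≤ |c|`), read on the line model through a LINE MULTIPLIER `ξ ∈ M` with `φ(X_W y) = ξ·φ y` (any polynomial in `γ₂`: `ξ` = the same polynomial in `lam`;
the SQUARE token `X = (Γ − 1)²` of the pieces `sqLevel_b`, `f_reg` has `ξ = (lam − 1)²`, `x₁₁ = (u₀₀ − 1)²`).  On a cone cell `φ(B₂) = Λ = x₀·𝒪_j ∈ levelSetDep(j, b; μ)`,
`μ = lam − jE u₀₀`, the token is `(jE c)⁻¹ξ ∈ 𝒪_j ∧ μ_X·Λ^♯ ⊆ Λ` with `μ_X := (jE c)⁻¹(ξ − jE x₁₁)` (§2), so the cut cone cells are the TWO-MULTIPLIER cells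
**`levelSetDep(j, b; μ) ∩ levelSetDep(j, b; μ_X)`** — the currency of LH4-p04 (g6)'s ★ p858876 two-multiplier RamM tables (`ncard_levelSetDep_inter_eq_of_generic_ramified`);
the axis is ★ p858844's two-multiplier W-side census at `lam′ = (jE c)⁻¹ξ`; the weights `f` are ★ T1's norm-residue counts, UNCHANGED.  ★ p858894 (depth token) is the case
`ξ = lam − 1`, `x₁₁ = u₀₀ − 1`, where the second cell clause collapses into the first.
* §1 the generic token through `φ`; (C₂^X) the count transport; the axis in M-letters. §2 the cut cone index set as `S_b ∩ {token}` and the token on a presented cell.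
* §3 the cut cone layer in M-letters (★ p857411 with the indicator-weighted fibre count); §4 HEAD.
HONEST LABEL.  Count-neutral lattice bookkeeping; nothing printed is asserted; no census law is stated; `HC_CM` is proved only modulo the 7 printed citations (2 remaining named
inputs: hLiu418 = `stmt-HodgeConjecture-24832`, h413 = `stmt-HodgeConjecture-24833`) until rung 0 closes.

## References
* [Kottwitz1986BaseChangeUnits] R. E. Kottwitz, *Base change for unit elements of Hecke algebras*, Compositio Math. 60 (1986), §1 pp. 240–241.
* [BruhatTits1972] F. Bruhat, J. Tits, *Groupes réductifs sur un corps local I*, Publ. Math. IHÉS 41 (1972), §10.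
* [Jacobowitz1962] R. Jacobowitz, *Hermitian forms over local fields*, Amer. J. Math. 84 (1962), §4.
* [Flicker1998UnitaryFL] Y. Z. Flicker, *Elementary proof of the fundamental lemma for a unitary group*, Canad. J. Math. 50 (1998), p. 84 REMARK.
-/

set_option autoImplicit false

noncomputable section

open scoped Valued WithZero Matrix MatrixGroups
open WithZero
open scoped Classical
open Literature.NumberTheory.Automorphic Literature.NumberTheory.Automorphic.HermitianLattice Literature.NumberTheory.Automorphic.UnitaryLatticeTree
open Literature.NumberTheory.Rogawski1990
open Literature.NumberTheory.Automorphic.EllipticPlaneAsFieldLine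
open Literature.NumberTheory.LocalFields.QuadraticOrder
open Summit.HodgeConjecture.HodgeConjecture.Cruxes.H413.F0P3cDyRamToricCensusDefs
open Summit.HodgeConjecture.HodgeConjecture.Cruxes.H413.F0P3cDyRamWSideOrderCensus
open Summit.HodgeConjecture.HodgeConjecture.Cruxes.H413.F0P3cDyRamConeLevelTransport
open Summit.HodgeConjecture.HodgeConjecture.Cruxes.H413.F0P3cDyRamBlockGlueCount
open Summit.HodgeConjecture.HodgeConjecture.Cruxes.H413.F0P3cDyRamBlockGluePlane
open Summit.HodgeConjecture.HodgeConjecture.Cruxes.H413.F0P3cDyRamBlockGlueLevelCount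
open Summit.HodgeConjecture.HodgeConjecture.Cruxes.H413.F0P3cDyRamBlockGlueTokenCount
open Summit.HodgeConjecture.HodgeConjecture.Cruxes.H413.F0P3cDyRamBlockCensusOrderForm
open Summit.HodgeConjecture.HodgeConjecture.Cruxes.H413.F0P3cDyRamBlockCensusOrderFormLevelAxis
open Summit.HodgeConjecture.HodgeConjecture.Cruxes.H413.F0P3cDyRamBlockCensusOrderFormLevel

namespace Summit.HodgeConjecture.HodgeConjecture.Cruxes.H413.F0P3cDyRamBlockCensusOrderFormToken

variable {E M : Type*} [Field E] [Valued E ℤᵐ⁰] [Field M] [Valued M ℤᵐ⁰] {ρ Θ : M →+* M} {α : M}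

/-! ## §1 The generic token through the line model; the count transport; the axis in M-letters -/

omit [Valued M ℤᵐ⁰] in
/-- **THE GENERIC TOKEN THROUGH `φ`**: if `φ(X_W y) = ξ·φ y` then `(∀ y ∈ B, c⁻¹·X_W y ∈ B) ⟺ (∀ x ∈ φB, (jE c)⁻¹ξ·x ∈ φB)`. [cite: Flicker1998UnitaryFL, p. 84 REMARK] -/
theorem forall_inv_smul_mulVec_mem_iff_of_line (jE : E →+* M) (φ : (Fin 2 → E) →+ M) (hφs : ∀ (c : E) (x : Fin 2 → E), φ (c • x) = jE c * φ x)
    (hφi : Function.Injective φ) {XW : Matrix (Fin 2) (Fin 2) E} {ξ : M} (hξ : ∀ y, φ (XW *ᵥ y) = ξ * φ y) (c : E) (B : Submodule 𝒪[E] (Fin 2 → E)) :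
    (∀ y ∈ B, c⁻¹ • (XW *ᵥ y) ∈ B) ↔ ∀ x ∈ B.toAddSubgroup.map φ, (jE c)⁻¹ * ξ * x ∈ B.toAddSubgroup.map φ := by
  have key : ∀ y : Fin 2 → E, φ (c⁻¹ • (XW *ᵥ y)) = (jE c)⁻¹ * ξ * φ y := fun y => by
    rw [hφs, map_inv₀, hξ]; ring
  constructor
  · intro hB x hx
    obtain ⟨y, hy, rfl⟩ := AddSubgroup.mem_map.1 hx
    rw [← key]
    exact AddSubgroup.mem_map.2 ⟨_, hB y hy, rfl⟩
  · intro hΛ y hy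
    have h1 := hΛ (φ y) (AddSubgroup.mem_map.2 ⟨y, hy, rfl⟩)
    rw [← key] at h1
    obtain ⟨y', hy', hyy⟩ := AddSubgroup.mem_map.1 h1
    rw [← hφi hyy]
    exact hy'

/-- **(C₂^X) THE COUNT TRANSPORT WITH A GENERIC TOKEN**: the `γ₂`-fixed self-dual plane lattices with `c⁻¹X_W·B ⊆ B` are equinumerous with the `lam`-stable,
`(jE c)⁻¹ξ`-stable, hermitian-self-dual order lattices (★ (C)'s bijection `B ↦ φ(B)`). [cite: Kottwitz1986BaseChangeUnits, §1 pp. 240–241] [cite: Flicker1998UnitaryFL, p. 84 REMARK] [cite: Jacobowitz1962, §4] -/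
theorem ncard_selfDual_fixed_token_eq_ncard_orderLatt₂ (σ : E →+* E) (hvσ : ∀ a, Valued.v (σ a) = Valued.v a) {ϖ : E} (hϖ0 : ϖ ≠ 0) (hϖ1 : Valued.v ϖ ≤ 1)
    {H₂ : Matrix (Fin 2) (Fin 2) E} (hH₂ : IsUnit H₂.det) (jE : E →+* M)
    (hρρ : ∀ x, ρ (ρ x) = x) (hvρ : ∀ x, Valued.v (ρ x) = Valued.v x) (hα : ρ α ≠ α) (hα1 : Valued.v α ≤ 1)
    (hint : ∀ z : M, Valued.v z ≤ 1 → Valued.v ((z - ρ z) / (α - ρ α)) ≤ 1)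
    (hjv : ∀ c, Valued.v (jE c) ≤ 1 ↔ Valued.v c ≤ 1) (hjfix : ∀ z, ρ z = z ↔ ∃ c, jE c = z)
    (φ : (Fin 2 → E) →+ M) (hφs : ∀ (c : E) (x : Fin 2 → E), φ (c • x) = jE c * φ x) (hφi : Function.Injective φ) (hφo : Function.Surjective φ)
    {γ₂ : GL (Fin 2) E} {lam h : M} (hφγ : ∀ x, φ ((γ₂ : Matrix (Fin 2) (Fin 2) E).mulVec x) = lam * φ x) (hlam : Valued.v lam = 1)
    (hform : ∀ x y, jE (pairing σ H₂ x y) = h * Θ (φ x) * φ y + ρ (h * Θ (φ x) * φ y))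
    {XW : Matrix (Fin 2) (Fin 2) E} {ξ : M} (hξ : ∀ y, φ (XW *ᵥ y) = ξ * φ y) (c : E) :
    {B : Submodule 𝒪[E] (Fin 2 → E) | IsSelfDualLattice σ ϖ H₂ B ∧ mapGL γ₂ B = B ∧ ∀ y ∈ B, c⁻¹ • (XW *ᵥ y) ∈ B}.ncard =
      {Λ : AddSubgroup M | (∃ z c' : M, z ≠ 0 ∧ ρ c' = c' ∧ c' ≠ 0 ∧ Valued.v c' ≤ 1 ∧
          ∀ x, x ∈ Λ ↔ ∃ y, (Valued.v y ≤ 1 ∧ Valued.v (y - ρ y) ≤ Valued.v (c' * (α - ρ α))) ∧ x = z * y) ∧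
        (∀ x ∈ Λ, lam * x ∈ Λ) ∧ (∀ x ∈ Λ, (jE c)⁻¹ * ξ * x ∈ Λ) ∧ (∀ m, (∀ a ∈ Λ, Valued.v (h * Θ a * m + ρ (h * Θ a * m)) ≤ 1) ↔ m ∈ Λ)}.ncard := by
  classical
  refine Set.ncard_congr (fun B _ => B.toAddSubgroup.map φ) ?_ ?_ ?_
  · rintro B ⟨hSD, hfix, hlev⟩
    have hdual : dualLatt σ H₂ B = B := dualLatt_eq_self_of_isSelfDualLattice hvσ hH₂ hSD
    have hlev' := (forall_inv_smul_mulVec_mem_iff_of_line jE φ hφs hφi hξ c B).1 hlev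
    obtain ⟨g, hBg, -, -, -⟩ := hSD
    subst hBg
    refine ⟨?_, ?_, hlev', ?_⟩
    · exact exists_eq_mul_order_map_latt jE hρρ hα hα1 hint hjv hjfix φ hφs hφi g
    · exact (mapGL_eq_iff_forall_mul_mem jE hρρ hvρ hα hα1 hint hjv hjfix φ hφs hφi hφγ hlam g).1 hfix
    · exact forall_herm_iff_mem_of_dualLatt_eq σ H₂ jE ρ Θ h hjv φ hφi hφo hform hdual
  · intro B B' _ _ hBB'
    exact map_toAddSubgroup_injective φ hφi hBB'
  · rintro Λ ⟨⟨z, c', hz0, hcfix, hc0, hc1, hΛ⟩, hstab, hstab', hself⟩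
    obtain ⟨g, hg⟩ := exists_latt_map_eq_of_order jE hρρ hα hα1 hint hjv hjfix φ hφs hφo hz0 hcfix hc0 hc1 hΛ
    refine ⟨latt (g : Matrix (Fin 2) (Fin 2) E), ⟨?_, ?_, ?_⟩, hg⟩
    · refine isSelfDualLattice_latt_of_dualLatt_eq σ hvσ hϖ0 hϖ1 hH₂ g ?_
      refine dualLatt_eq_of_forall_herm_iff_mem σ H₂ jE ρ Θ h hjv φ hφi hform ?_
      rw [hg]; exact hself
    · refine (mapGL_eq_iff_forall_mul_mem jE hρρ hvρ hα hα1 hint hjv hjfix φ hφs hφi hφγ hlam g).2 ?_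
      rw [hg]; exact hstab
    · refine (forall_inv_smul_mulVec_mem_iff_of_line jE φ hφs hφi hξ c _).2 ?_
      rw [hg]; exact hstab'

/-- **AXIS TERM WITH A GENERIC TOKEN, IN M-LETTERS**: `#{B ∣ SD_W, γ₂B = B, c⁻¹X_W·B ⊆ B} = Σ_{j<J+1} [IsOrd_j lam ∧ IsOrd_j ((jE c)⁻¹ξ)]·#levelSet(j, 0)` — (C₂^X) ∘ ★ p858844
(W4₂). [cite: Kottwitz1986BaseChangeUnits, §1 pp. 240–241] [cite: Flicker1998UnitaryFL, p. 84 REMARK] [cite: Jacobowitz1962, §4] -/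
theorem ncard_selfDual_fixed_token_plane_eq_sum_levelSet_zero (σ : E →+* E) (hvσ : ∀ a, Valued.v (σ a) = Valued.v a) {ϖ : E} (hϖ : Valued.v ϖ = WithZero.exp (-1 : ℤ))
    {H₂ : Matrix (Fin 2) (Fin 2) E} (hH₂ : IsUnit H₂.det) (jE : E →+* M)
    (hρρ : ∀ x, ρ (ρ x) = x) (hvρ : ∀ x, Valued.v (ρ x) = Valued.v x) (hα : ρ α ≠ α) (hα1 : Valued.v α ≤ 1)
    (hint : ∀ z : M, Valued.v z ≤ 1 → Valued.v ((z - ρ z) / (α - ρ α)) ≤ 1)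
    (hΘΘ : ∀ x, Θ (Θ x) = x) (hΘρ : ∀ x, Θ (ρ x) = ρ (Θ x)) (hvΘ : ∀ x, Valued.v (Θ x) = Valued.v x)
    (hjv : ∀ c, Valued.v (jE c) ≤ 1 ↔ Valued.v c ≤ 1) (hjfix : ∀ z, ρ z = z ↔ ∃ c, jE c = z)
    (hjpow : ∀ (t : E) (n : ℤ), Valued.v (jE t) = Valued.v (jE ϖ) ^ n ↔ Valued.v t = Valued.v ϖ ^ n)
    (hEval : ∀ c : M, ρ c = c → c ≠ 0 → Valued.v c ≤ 1 → ∃ n : ℕ, Valued.v c = Valued.v (jE ϖ) ^ n)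
    (φ : (Fin 2 → E) →+ M) (hφs : ∀ (c : E) (x : Fin 2 → E), φ (c • x) = jE c * φ x) (hφi : Function.Injective φ) (hφo : Function.Surjective φ)
    {γ₂ : GL (Fin 2) E} {lam h : M} (hφγ : ∀ x, φ ((γ₂ : Matrix (Fin 2) (Fin 2) E).mulVec x) = lam * φ x) (hlam : Valued.v lam = 1)
    (hh : h ≠ 0) (hform : ∀ x y, jE (pairing σ H₂ x y) = h * Θ (φ x) * φ y + ρ (h * Θ (φ x) * φ y))
    {J : ℕ} (hJ : ¬ IsOrd ρ α (jE ϖ ^ (J + 1)) lam) (hfin0 : ∀ j, (levelSet ρ Θ α (jE ϖ) h j 0).Finite)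
    {XW : Matrix (Fin 2) (Fin 2) E} {ξ : M} (hξ : ∀ y, φ (XW *ᵥ y) = ξ * φ y) (c : E) :
    {B : Submodule 𝒪[E] (Fin 2 → E) | IsSelfDualLattice σ ϖ H₂ B ∧ mapGL γ₂ B = B ∧ ∀ y ∈ B, c⁻¹ • (XW *ᵥ y) ∈ B}.ncard =
      ∑ j ∈ Finset.range (J + 1),
        (if IsOrd ρ α (jE ϖ ^ j) lam ∧ IsOrd ρ α (jE ϖ ^ j) ((jE c)⁻¹ * ξ) then (levelSet ρ Θ α (jE ϖ) h j 0).ncard else 0) := by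
  have hvϖ0 : Valued.v ϖ ≠ 0 := by rw [hϖ]; exact WithZero.exp_ne_zero
  have hϖ0 : ϖ ≠ 0 := fun h0 => by rw [h0, map_zero] at hvϖ0; exact hvϖ0 rfl
  have hϖ1 : Valued.v ϖ < 1 := by rw [hϖ, ← WithZero.exp_zero, WithZero.exp_lt_exp]; norm_num
  have hρϖ : ρ (jE ϖ) = jE ϖ := (hjfix _).2 ⟨ϖ, rfl⟩
  have hϖE0 : jE ϖ ≠ 0 := (map_ne_zero jE).2 hϖ0
  have hϖE1 : Valued.v (jE ϖ) < 1 := by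
    refine lt_of_le_of_ne ((hjv ϖ).2 hϖ1.le) fun hle => ?_
    have := (hjpow ϖ 0).1 (by rw [zpow_zero]; exact hle)
    rw [zpow_zero] at this
    exact hϖ1.ne this
  rw [ncard_selfDual_fixed_token_eq_ncard_orderLatt₂ σ hvσ hϖ0 hϖ1.le hH₂ jE hρρ hvρ hα hα1 hint hjv hjfix φ hφs hφi hφo hφγ hlam hform hξ c]
  exact ncard_orderLatt_selfDual_stable₂_eq_sum hρρ hvρ hα hα1 hint hΘΘ hΘρ hvΘ hρϖ hϖE0 hϖE1 hEval hh lam _ hJ hfin0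

/-! ## §2 The cut cone index set as `S_b ∩ {token}`; the token on a presented cell -/

/-- **`S_b^{X,c} = S_b ∩ {c⁻¹X_W·(·) ⊆ · ∧ (c⁻¹(X_W − x₁₁))·(·)^♯ ⊆ ·}`** (`H₂` hermitian, `σ` an isometric involution, guard `|x₁₁| ≤ |c|`).
[cite: Jacobowitz1962, §4] [cite: Kottwitz1986BaseChangeUnits, §1 pp. 240–241] -/
theorem tokenConeIndex_eq_inter (σ : E →+* E) (hσ : ∀ a, σ (σ a) = a) (hvσ : ∀ a, Valued.v (σ a) = Valued.v a) (ϖ : E)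
    {H₂ : Matrix (Fin 2) (Fin 2) E} (hH₂σ : (H₂.map σ)ᵀ = H₂) (γ₂ : GL (Fin 2) E) (u : E) (XW : Matrix (Fin 2) (Fin 2) E) {x₁₁ c : E} (hc : c ≠ 0)
    (hxc : Valued.v x₁₁ ≤ Valued.v c) (b : ℕ) :
    {B : Submodule 𝒪[E] (Fin 2 → E) | (∃ g : GL (Fin 2) E, B = latt (g : Matrix (Fin 2) (Fin 2) E)) ∧ mapGL γ₂ B = B ∧
        (∀ y ∈ B, c⁻¹ • (XW *ᵥ y) ∈ B) ∧
        ∃ w₀ : Fin 2 → E, (∀ w, w ∈ B ↔ (w ∈ dualLatt σ H₂ B ∧ Valued.v (pairing σ H₂ w₀ w) ≤ 1)) ∧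
          (∀ w ∈ dualLatt σ H₂ B, ∃ (t : E) (a : Fin 2 → E), Valued.v t ≤ 1 ∧ a ∈ B ∧ w = t • w₀ + a) ∧
          Valued.v (pairing σ H₂ w₀ w₀) * Valued.v ϖ ^ (2 * b) = 1 ∧
          (γ₂ : Matrix (Fin 2) (Fin 2) E).mulVec w₀ - u • w₀ ∈ B ∧ c⁻¹ • (XW *ᵥ w₀ - x₁₁ • w₀) ∈ B} =
      {B : Submodule 𝒪[E] (Fin 2 → E) | (∃ g : GL (Fin 2) E, B = latt (g : Matrix (Fin 2) (Fin 2) E)) ∧ mapGL γ₂ B = B ∧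
        ∃ w₀ : Fin 2 → E, (∀ w, w ∈ B ↔ (w ∈ dualLatt σ H₂ B ∧ Valued.v (pairing σ H₂ w₀ w) ≤ 1)) ∧
          (∀ w ∈ dualLatt σ H₂ B, ∃ (t : E) (a : Fin 2 → E), Valued.v t ≤ 1 ∧ a ∈ B ∧ w = t • w₀ + a) ∧
          Valued.v (pairing σ H₂ w₀ w₀) * Valued.v ϖ ^ (2 * b) = 1 ∧ (γ₂ : Matrix (Fin 2) (Fin 2) E).mulVec w₀ - u • w₀ ∈ B} ∩
      {B : Submodule 𝒪[E] (Fin 2 → E) | (∀ y ∈ B, c⁻¹ • (XW *ᵥ y) ∈ B) ∧ ∀ w ∈ dualLatt σ H₂ B, c⁻¹ • (XW *ᵥ w - x₁₁ • w) ∈ B} := by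
  have hH₂h : ∀ a d : Fin 2, σ (H₂ a d) = H₂ d a := fun a d => by
    have e := congrFun (congrFun hH₂σ d) a
    rwa [Matrix.transpose_apply, Matrix.map_apply] at e
  have hsymm₂ : ∀ x y : Fin 2 → E, Valued.v (pairing σ H₂ y x) = Valued.v (pairing σ H₂ x y) := v_pairing_comm_of_hermitian hvσ hσ hH₂h
  have hvc : 0 < Valued.v c := zero_lt_iff.2 ((Valuation.ne_zero_iff _).2 hc)
  have hu' : Valued.v (c⁻¹ * x₁₁) ≤ 1 := by rw [map_mul, map_inv₀, ← div_eq_inv_mul, div_le_one₀ hvc]; exact hxc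
  have hstabc : ∀ {B : Submodule 𝒪[E] (Fin 2 → E)}, (∀ y ∈ B, c⁻¹ • (XW *ᵥ y) ∈ B) → ∀ a ∈ B, c⁻¹ • (XW *ᵥ a - x₁₁ • a) ∈ B := by
    intro B hW a ha
    have e : c⁻¹ • (XW *ᵥ a - x₁₁ • a) = c⁻¹ • (XW *ᵥ a) - (c⁻¹ * x₁₁) • a := by rw [smul_sub, mul_smul]
    rw [e]
    exact B.sub_mem (hW a ha) (B.smul_mem (⟨c⁻¹ * x₁₁, hu'⟩ : 𝒪[E]) ha)
  ext B
  simp only [Set.mem_setOf_eq, Set.mem_inter_iff]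
  constructor
  · rintro ⟨hg, hγB, hW, w₀, hG1, hgen, hnorm, hplain, hdeep⟩
    refine ⟨⟨hg, hγB, w₀, hG1, hgen, hnorm, hplain⟩, hW, fun w hw => ?_⟩
    obtain ⟨t, a, ht, ha, rfl⟩ := hgen w hw
    have e : c⁻¹ • (XW *ᵥ (t • w₀ + a) - x₁₁ • (t • w₀ + a)) = t • (c⁻¹ • (XW *ᵥ w₀ - x₁₁ • w₀)) + c⁻¹ • (XW *ᵥ a - x₁₁ • a) := by
      rw [Matrix.mulVec_add, Matrix.mulVec_smul]
      module
    rw [e]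
    exact B.add_mem (B.smul_mem (⟨t, ht⟩ : 𝒪[E]) hdeep) (hstabc hW a ha)
  · rintro ⟨⟨hg, hγB, w₀, hG1, hgen, hnorm, hplain⟩, hW, hdual⟩
    have hw₀d : w₀ ∈ dualLatt σ H₂ B := fun y hy => by rw [hsymm₂]; exact ((hG1 y).1 hy).2
    exact ⟨hg, hγB, hW, w₀, hG1, hgen, hnorm, hplain, hdual w₀ hw₀d⟩

/-- **THE GENERIC TOKEN ON A PRESENTED CELL**: with `φ(X_W y) = ξ·φ y` and `φ(B) = x₀·𝒪_j` presented,
`(c⁻¹X_W·B ⊆ B ∧ (c⁻¹(X_W − x₁₁))·B^♯ ⊆ B) ⟺ (IsOrd_j ((jE c)⁻¹ξ) ∧ ∀ b′, (∀ x ∈ φB, |hΘ(x)b′ + ρ(hΘ(x)b′)| ≤ 1) → ((jE c)⁻¹(ξ − jE x₁₁))·b′ ∈ φB)`.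
[cite: Jacobowitz1962, §4] [cite: Flicker1998UnitaryFL, p. 84 REMARK] -/
theorem token_iff_lineToken (σ : E →+* E) (H₂ : Matrix (Fin 2) (Fin 2) E) (jE : E →+* M) (h : M)
    (hvρ : ∀ x, Valued.v (ρ x) = Valued.v x) (hjv : ∀ c, Valued.v (jE c) ≤ 1 ↔ Valued.v c ≤ 1)
    (φ : (Fin 2 → E) →+ M) (hφs : ∀ (c : E) (x : Fin 2 → E), φ (c • x) = jE c * φ x) (hφi : Function.Injective φ) (hφo : Function.Surjective φ)
    (hform : ∀ x y, jE (pairing σ H₂ x y) = h * Θ (φ x) * φ y + ρ (h * Θ (φ x) * φ y))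
    {XW : Matrix (Fin 2) (Fin 2) E} {ξ : M} (hξ : ∀ y, φ (XW *ᵥ y) = ξ * φ y)
    (x₁₁ c : E) {j : ℕ} {ϖM : M} {B : Submodule 𝒪[E] (Fin 2 → E)} {x₀ : M} (hx₀ : x₀ ≠ 0)
    (hΛx : ∀ x, x ∈ B.toAddSubgroup.map φ ↔ ∃ z, IsOrd ρ α (ϖM ^ j) z ∧ x = x₀ * z) :
    ((∀ y ∈ B, c⁻¹ • (XW *ᵥ y) ∈ B) ∧ ∀ w ∈ dualLatt σ H₂ B, c⁻¹ • (XW *ᵥ w - x₁₁ • w) ∈ B) ↔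
      (IsOrd ρ α (ϖM ^ j) ((jE c)⁻¹ * ξ) ∧
        ∀ b', (∀ x ∈ B.toAddSubgroup.map φ, Valued.v (h * Θ x * b' + ρ (h * Θ x * b')) ≤ 1) → ((jE c)⁻¹ * (ξ - jE x₁₁)) * b' ∈ B.toAddSubgroup.map φ) := by
  have key : ∀ w : Fin 2 → E, φ (c⁻¹ • (XW *ᵥ w - x₁₁ • w)) = (jE c)⁻¹ * (ξ - jE x₁₁) * φ w := fun w => by
    rw [hφs, map_inv₀, map_sub, hξ, hφs]; ring
  refine and_congr ?_ ?_
  · rw [forall_inv_smul_mulVec_mem_iff_of_line jE φ hφs hφi hξ c B, forall_mul_mem_iff_isOrd hvρ hx₀ hΛx]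
  · constructor
    · intro hdual b' hb'
      obtain ⟨w, rfl⟩ := hφo b'
      have hw : w ∈ dualLatt σ H₂ B := (mem_dualLatt_iff_forall_v_herm_le_one σ H₂ jE ρ Θ h hjv φ hform B w).2 hb'
      rw [← key]
      exact AddSubgroup.mem_map.2 ⟨_, hdual w hw, rfl⟩
    · intro hline w hw
      have hb' := hline (φ w) ((mem_dualLatt_iff_forall_v_herm_le_one σ H₂ jE ρ Θ h hjv φ hform B w).1 hw)
      rw [← key] at hb'
      obtain ⟨y', hy', hyy⟩ := AddSubgroup.mem_map.1 hb'
      rw [← hφi hyy]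
      exact hy'

/-! ## §3 The cut cone layer in M-letters -/

/-- **THE CUT CONE LAYER `b ≥ 1` WITH A GENERIC TOKEN, IN M-LETTERS** (frame of ★ (C1) §2; `φ(X_W y) = ξ·φ y`; `c ≠ 0`, guard `|x₁₁| ≤ |c|`):
`Σᶠ_{B₂ ∈ S_b^{X,c}} #fibre(ι_W B₂, b) = Σ_{j<J+1} [IsOrd_j lam ∧ IsOrd_j ((jE c)⁻¹ξ)]·Σᶠ_{Λ ∈ levelSetDep(j, b; lam − jE u) ∩ levelSetDep(j, b; (jE c)⁻¹(ξ − jE x₁₁))} f b j Λ`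
— the TWO-MULTIPLIER cells. [cite: Kottwitz1986BaseChangeUnits, §1 pp. 240–241] [cite: BruhatTits1972, §10] [cite: Jacobowitz1962, §4] -/
theorem finsum_ncard_glueFibre_token_eq_sum_levelSetDep_inter [IsPrincipalIdealRing 𝒪[E]] (σ : E →+* E) (hσ : ∀ a, σ (σ a) = a)
    (hvσ : ∀ a, Valued.v (σ a) = Valued.v a) {ϖ : E} (hϖ : Valued.v ϖ = WithZero.exp (-1 : ℤ))
    {H₂ : Matrix (Fin 2) (Fin 2) E} (hH₂ : IsUnit H₂.det) (hH₂σ : (H₂.map σ)ᵀ = H₂) {hW : E} (hhW : Valued.v hW = 1) (hhWσ : σ hW = hW) (jE : E →+* M)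
    (hρρ : ∀ x, ρ (ρ x) = x) (hvρ : ∀ x, Valued.v (ρ x) = Valued.v x) (hα : ρ α ≠ α) (hα1 : Valued.v α ≤ 1)
    (hint : ∀ z : M, Valued.v z ≤ 1 → Valued.v ((z - ρ z) / (α - ρ α)) ≤ 1)
    (hΘΘ : ∀ x, Θ (Θ x) = x) (hΘρ : ∀ x, Θ (ρ x) = ρ (Θ x)) (hvΘ : ∀ x, Valued.v (Θ x) = Valued.v x) (hΘj : ∀ x, Θ (jE x) = jE (σ x))
    (hjv : ∀ c, Valued.v (jE c) ≤ 1 ↔ Valued.v c ≤ 1) (hjfix : ∀ z, ρ z = z ↔ ∃ c, jE c = z)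
    (hjpow : ∀ (t : E) (n : ℤ), Valued.v (jE t) = Valued.v (jE ϖ) ^ n ↔ Valued.v t = Valued.v ϖ ^ n)
    (hEval : ∀ c : M, ρ c = c → c ≠ 0 → Valued.v c ≤ 1 → ∃ n : ℕ, Valued.v c = Valued.v (jE ϖ) ^ n)
    (hϖmax : ∀ t : M, ρ t = t → Valued.v t < 1 → Valued.v t ≤ Valued.v (jE ϖ))
    (φ : (Fin 2 → E) →+ M) (hφs : ∀ (c : E) (x : Fin 2 → E), φ (c • x) = jE c * φ x) (hφi : Function.Injective φ) (hφo : Function.Surjective φ)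
    {γ₂ : GL (Fin 2) E} {lam h : M} (hφγ : ∀ x, φ ((γ₂ : Matrix (Fin 2) (Fin 2) E).mulVec x) = lam * φ x) (hlam : Valued.v lam = 1)
    (hΘh : Θ h = h) (hh : h ≠ 0) (hform : ∀ x y, jE (pairing σ H₂ x y) = h * Θ (φ x) * φ y + ρ (h * Θ (φ x) * φ y))
    (u : E) (hu : Valued.v u ≤ 1) {XW : Matrix (Fin 2) (Fin 2) E} {ξ : M} (hξ : ∀ y, φ (XW *ᵥ y) = ξ * φ y) {x₁₁ c : E} (hc : c ≠ 0)
    (hxc : Valued.v x₁₁ ≤ Valued.v c)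
    {b : ℕ} (hb : 1 ≤ b) {J : ℕ} (hJ : ¬ IsOrd ρ α (jE ϖ ^ (J + 1)) lam)
    (hfin : ∀ j, j ≤ J → (levelSet ρ Θ α (jE ϖ) h j b).Finite)
    (f : ℕ → ℕ → AddSubgroup M → ℕ)
    (hf : ∀ (b j : ℕ) (Λ : AddSubgroup M) (x₀ : M) (r : E), 1 ≤ b → x₀ ≠ 0 →
      (∀ x, x ∈ Λ ↔ ∃ z, IsOrd ρ α (jE ϖ ^ j) z ∧ x = x₀ * z) →
      IsOrd ρ α (jE ϖ ^ j) (dualGen ρ Θ α (jE ϖ ^ j) h x₀) → ¬ IsOrd ρ α (jE ϖ ^ j) (dualGen ρ Θ α (jE ϖ ^ j) h x₀ / jE ϖ) →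
      Valued.v (dualGen ρ Θ α (jE ϖ ^ j) h x₀) = Valued.v (jE ϖ) ^ b →
      (∀ b', (∀ x ∈ Λ, Valued.v (h * Θ x * b' + ρ (h * Θ x * b')) ≤ 1) → (lam - jE u) * b' ∈ Λ) →
      IsOrd ρ α (jE ϖ ^ j) lam → jE r = glueUnit ρ Θ α (jE ϖ ^ j) h (jE ϖ) (jE hW) x₀ b →
      f b j Λ = Nat.card {x : 𝒪[E] ⧸ 𝓂[E] ^ (2 * b) // ∃ u' : 𝒪[E], Ideal.Quotient.mk (𝓂[E] ^ (2 * b)) u' = x ∧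
        Valued.v ((u' : E) * σ u' - r) ≤ Valued.v (ϖ ^ (2 * b))}) :
    ∑ᶠ B₂ ∈ {B : Submodule 𝒪[E] (Fin 2 → E) | (∃ g : GL (Fin 2) E, B = latt (g : Matrix (Fin 2) (Fin 2) E)) ∧ mapGL γ₂ B = B ∧
        (∀ y ∈ B, c⁻¹ • (XW *ᵥ y) ∈ B) ∧
        ∃ w₀ : Fin 2 → E, (∀ w, w ∈ B ↔ (w ∈ dualLatt σ H₂ B ∧ Valued.v (pairing σ H₂ w₀ w) ≤ 1)) ∧
          (∀ w ∈ dualLatt σ H₂ B, ∃ (t : E) (a : Fin 2 → E), Valued.v t ≤ 1 ∧ a ∈ B ∧ w = t • w₀ + a) ∧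
          Valued.v (pairing σ H₂ w₀ w₀) * Valued.v ϖ ^ (2 * b) = 1 ∧
          (γ₂ : Matrix (Fin 2) (Fin 2) E).mulVec w₀ - u • w₀ ∈ B ∧ c⁻¹ • (XW *ᵥ w₀ - x₁₁ • w₀) ∈ B},
        {L : Submodule 𝒪[E] (Fin 3 → E) | IsSelfDualLattice σ ϖ (!![H₂ 0 0, 0, H₂ 0 1; 0, hW, 0; H₂ 1 0, 0, H₂ 1 1] : Matrix (Fin 3) (Fin 3) E) L ∧
            L ⊓ LinearMap.ker ((LinearMap.proj (1 : Fin 3) : (Fin 3 → E) →ₗ[E] E).restrictScalars 𝒪[E]) =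
              B₂.map ((Matrix.toLin' (!![1, 0; 0, 0; 0, 1] : Matrix (Fin 3) (Fin 2) E)).restrictScalars 𝒪[E]) ∧
            ∀ c : E, (Pi.single 1 c : Fin 3 → E) ∈ L ↔ Valued.v c ≤ Valued.v ϖ ^ b}.ncard =
      ∑ j ∈ Finset.range (J + 1), (if IsOrd ρ α (jE ϖ ^ j) lam ∧ IsOrd ρ α (jE ϖ ^ j) ((jE c)⁻¹ * ξ) then
        ∑ᶠ Λ ∈ levelSetDep ρ Θ α (jE ϖ) h j b (lam - jE u) ∩ levelSetDep ρ Θ α (jE ϖ) h j b ((jE c)⁻¹ * (ξ - jE x₁₁)), f b j Λ else 0) := by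
  have hvϖ0 : Valued.v ϖ ≠ 0 := by rw [hϖ]; exact WithZero.exp_ne_zero
  have hϖ0 : ϖ ≠ 0 := fun h0 => by rw [h0, map_zero] at hvϖ0; exact hvϖ0 rfl
  have hϖ1 : Valued.v ϖ < 1 := by rw [hϖ, ← WithZero.exp_zero, WithZero.exp_lt_exp]; norm_num
  set T : Set (Submodule 𝒪[E] (Fin 2 → E)) := {B | (∀ y ∈ B, c⁻¹ • (XW *ᵥ y) ∈ B) ∧
    ∀ w ∈ dualLatt σ H₂ B, c⁻¹ • (XW *ᵥ w - x₁₁ • w) ∈ B} with hT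
  set fib : Submodule 𝒪[E] (Fin 2 → E) → ℕ := fun B₂ =>
    {L : Submodule 𝒪[E] (Fin 3 → E) | IsSelfDualLattice σ ϖ (!![H₂ 0 0, 0, H₂ 0 1; 0, hW, 0; H₂ 1 0, 0, H₂ 1 1] : Matrix (Fin 3) (Fin 3) E) L ∧
        L ⊓ LinearMap.ker ((LinearMap.proj (1 : Fin 3) : (Fin 3 → E) →ₗ[E] E).restrictScalars 𝒪[E]) =
          B₂.map ((Matrix.toLin' (!![1, 0; 0, 0; 0, 1] : Matrix (Fin 3) (Fin 2) E)).restrictScalars 𝒪[E]) ∧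
        ∀ c : E, (Pi.single 1 c : Fin 3 → E) ∈ L ↔ Valued.v c ≤ Valued.v ϖ ^ b}.ncard with hfib
  rw [tokenConeIndex_eq_inter σ hσ hvσ ϖ hH₂σ γ₂ u XW hc hxc b]
  rw [show (∑ᶠ B₂ ∈ {B : Submodule 𝒪[E] (Fin 2 → E) | (∃ g : GL (Fin 2) E, B = latt (g : Matrix (Fin 2) (Fin 2) E)) ∧ mapGL γ₂ B = B ∧
        ∃ w₀ : Fin 2 → E, (∀ w, w ∈ B ↔ (w ∈ dualLatt σ H₂ B ∧ Valued.v (pairing σ H₂ w₀ w) ≤ 1)) ∧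
          (∀ w ∈ dualLatt σ H₂ B, ∃ (t : E) (a : Fin 2 → E), Valued.v t ≤ 1 ∧ a ∈ B ∧ w = t • w₀ + a) ∧
          Valued.v (pairing σ H₂ w₀ w₀) * Valued.v ϖ ^ (2 * b) = 1 ∧ (γ₂ : Matrix (Fin 2) (Fin 2) E).mulVec w₀ - u • w₀ ∈ B} ∩ T, fib B₂) =
      ∑ᶠ B₂ ∈ {B : Submodule 𝒪[E] (Fin 2 → E) | (∃ g : GL (Fin 2) E, B = latt (g : Matrix (Fin 2) (Fin 2) E)) ∧ mapGL γ₂ B = B ∧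
        ∃ w₀ : Fin 2 → E, (∀ w, w ∈ B ↔ (w ∈ dualLatt σ H₂ B ∧ Valued.v (pairing σ H₂ w₀ w) ≤ 1)) ∧
          (∀ w ∈ dualLatt σ H₂ B, ∃ (t : E) (a : Fin 2 → E), Valued.v t ≤ 1 ∧ a ∈ B ∧ w = t • w₀ + a) ∧
          Valued.v (pairing σ H₂ w₀ w₀) * Valued.v ϖ ^ (2 * b) = 1 ∧ (γ₂ : Matrix (Fin 2) (Fin 2) E).mulVec w₀ - u • w₀ ∈ B}, T.indicator fib B₂ by
    rw [finsum_mem_def, finsum_mem_def, Set.indicator_indicator]]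
  rw [finsum_coneWParts_eq_sum σ hϖ0 hϖ1 H₂ jE hρρ hvρ hα hα1 hint hΘΘ hΘρ hvΘ hjv hjfix hjpow hEval hϖmax φ hφs hφi hφo hφγ hlam hΘh hh hform hu hb hJ hfin
    (T.indicator fib)
    (fun j Λ => if IsOrd ρ α (jE ϖ ^ j) ((jE c)⁻¹ * ξ) ∧
      (∀ b', (∀ x ∈ Λ, Valued.v (h * Θ x * b' + ρ (h * Θ x * b')) ≤ 1) → ((jE c)⁻¹ * (ξ - jE x₁₁)) * b' ∈ Λ) then f b j Λ else 0)
    fun j B₂ hBdep hlamj => ?_]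
  · refine Finset.sum_congr rfl fun j _ => ?_
    by_cases hlamj : IsOrd ρ α (jE ϖ ^ j) lam
    · rw [if_pos hlamj]
      by_cases hlam' : IsOrd ρ α (jE ϖ ^ j) ((jE c)⁻¹ * ξ)
      · rw [if_pos ⟨hlamj, hlam'⟩, finsum_mem_def, finsum_mem_def]
        refine finsum_congr fun Λ => ?_
        by_cases hΛ : Λ ∈ levelSetDep ρ Θ α (jE ϖ) h j b (lam - jE u)
        · rw [Set.indicator_of_mem hΛ]
          have hΛ2 := hΛ
          obtain ⟨hlev, -⟩ := hΛ2
          by_cases hdep' : ∀ b', (∀ x ∈ Λ, Valued.v (h * Θ x * b' + ρ (h * Θ x * b')) ≤ 1) → ((jE c)⁻¹ * (ξ - jE x₁₁)) * b' ∈ Λ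
          · have hΛ' : Λ ∈ levelSetDep ρ Θ α (jE ϖ) h j b (lam - jE u) ∩ levelSetDep ρ Θ α (jE ϖ) h j b ((jE c)⁻¹ * (ξ - jE x₁₁)) :=
              ⟨hΛ, hlev, hdep'⟩
            rw [Set.indicator_of_mem hΛ', if_pos ⟨hlam', hdep'⟩]
          · have hΛ' : Λ ∉ levelSetDep ρ Θ α (jE ϖ) h j b (lam - jE u) ∩ levelSetDep ρ Θ α (jE ϖ) h j b ((jE c)⁻¹ * (ξ - jE x₁₁)) :=
              fun h' => hdep' h'.2.2
            rw [Set.indicator_of_notMem hΛ', if_neg (fun h' => hdep' h'.2)]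
        · have hΛ' : Λ ∉ levelSetDep ρ Θ α (jE ϖ) h j b (lam - jE u) ∩ levelSetDep ρ Θ α (jE ϖ) h j b ((jE c)⁻¹ * (ξ - jE x₁₁)) :=
            fun h' => hΛ h'.1
          rw [Set.indicator_of_notMem hΛ, Set.indicator_of_notMem hΛ']
      · rw [if_neg (fun h' => hlam' h'.2), finsum_mem_def]
        refine finsum_eq_zero_of_forall_eq_zero fun Λ => ?_
        by_cases hΛ : Λ ∈ levelSetDep ρ Θ α (jE ϖ) h j b (lam - jE u)
        · rw [Set.indicator_of_mem hΛ, if_neg (fun h' => hlam' h'.1)]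
        · rw [Set.indicator_of_notMem hΛ]
    · rw [if_neg hlamj, if_neg (fun h' => hlamj h'.1)]
  · obtain ⟨⟨x₀, hx₀, hΛx, hyO, hyprim, hylev⟩, hdepΛ⟩ := hBdep
    have htok := token_iff_lineToken σ H₂ jE h hvρ hjv φ hφs hφi hφo hform hξ x₁₁ c hx₀ hΛx
    by_cases hTB : B₂ ∈ T
    · rw [Set.indicator_of_mem hTB, if_pos (htok.1 hTB)]
      obtain ⟨r, hr⟩ := exists_map_eq_glueUnit (ρ := ρ) (Θ := Θ) (α := α) jE hρρ hΘρ hjfix (jE ϖ ^ j) h x₀ ϖ hW b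
      simp only [hfib]
      rw [ncard_glueFibre_eq_natCard_normFibre_of_gen σ hσ hvσ hϖ hH₂ hH₂σ hhW hhWσ jE hρρ hvρ hα hα1 hint hΘΘ hΘρ hvΘ hΘj hjv hjfix hjpow hϖmax φ hφs hφi hφo hφγ hlam
          hΘh hh hform u hb hx₀ hΛx hyO hyprim hylev hdepΛ hlamj hr,
        hf b j _ x₀ r hb hx₀ hΛx hyO hyprim hylev hdepΛ hlamj hr]
    · rw [Set.indicator_of_notMem hTB, if_neg (fun h' => hTB (htok.2 h'))]

/-! ## §4 HEAD — the block census with a generic token, in M-letters -/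

/-- **(C1-P^X) THE BLOCK CENSUS WITH A GENERIC BLOCK TOKEN, IN M-LETTERS (HEAD).**  Frame of ★ (C1) (block form over `E`, `Γ = endoGL (γ₂, u)` UNITARY, line model, finite fixed
family with tube coordinates `≤ R`, `lam ∉ 𝒪_{J+1}`, level sets finite, weights `f` = norm-residue counts on presented cells); `X` block at `1` with compression `X_W` and a LINE
MULTIPLIER `ξ` (`φ(X_W y) = ξ·φ y`); `c ≠ 0`, guard `|X₁₁| ≤ |c|`.  Then
`#{L ∣ SD, Γ·L = L, L.map X ≤ c·L} = Σ_{j<J+1} [IsOrd_j lam ∧ IsOrd_j ((jE c)⁻¹ξ)]·#levelSet(j, 0) + Σ_{b ∈ Icc 1 R} Σ_{j<J+1} [same]·Σᶠ_{Λ ∈ levelSetDep(j, b; lam − jE u₀₀) ∩ levelSetDep(j, b; (jE c)⁻¹(ξ − jE X₁₁))} f b j Λ`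
— ★ (this seat) `ncard_fixed_selfDual_endoGL_token_eq_axis_add_sum` ∘ §1 ∘ §3.  Square token: `X = (Γ − 1)²`, `X_W = (γ₂ − 1)²`, `ξ = (lam − 1)²`, `X₁₁ = (u₀₀ − 1)²`.
[cite: Kottwitz1986BaseChangeUnits, §1 pp. 240–241] [cite: BruhatTits1972, §10] [cite: Jacobowitz1962, §4] [cite: Flicker1998UnitaryFL, p. 84 REMARK] -/
theorem ncard_fixed_selfDual_endoGL_token_eq_orderForm [IsPrincipalIdealRing 𝒪[E]] (σ : E →+* E) (hσ : ∀ a, σ (σ a) = a) (hvσ : ∀ a, Valued.v (σ a) = Valued.v a)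
    {ϖ : E} (hϖ : Valued.v ϖ = WithZero.exp (-1 : ℤ))
    {H₂ : Matrix (Fin 2) (Fin 2) E} (hH₂ : IsUnit H₂.det) (hH₂σ : (H₂.map σ)ᵀ = H₂) {hW : E} (hhW : Valued.v hW = 1) (hhWσ : σ hW = hW) (jE : E →+* M)
    (hρρ : ∀ x, ρ (ρ x) = x) (hvρ : ∀ x, Valued.v (ρ x) = Valued.v x) (hα : ρ α ≠ α) (hα1 : Valued.v α ≤ 1)
    (hint : ∀ z : M, Valued.v z ≤ 1 → Valued.v ((z - ρ z) / (α - ρ α)) ≤ 1)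
    (hΘΘ : ∀ x, Θ (Θ x) = x) (hΘρ : ∀ x, Θ (ρ x) = ρ (Θ x)) (hvΘ : ∀ x, Valued.v (Θ x) = Valued.v x) (hΘj : ∀ x, Θ (jE x) = jE (σ x))
    (hjv : ∀ c, Valued.v (jE c) ≤ 1 ↔ Valued.v c ≤ 1) (hjfix : ∀ z, ρ z = z ↔ ∃ c, jE c = z)
    (hjpow : ∀ (t : E) (n : ℤ), Valued.v (jE t) = Valued.v (jE ϖ) ^ n ↔ Valued.v t = Valued.v ϖ ^ n)
    (hEval : ∀ c : M, ρ c = c → c ≠ 0 → Valued.v c ≤ 1 → ∃ n : ℕ, Valued.v c = Valued.v (jE ϖ) ^ n)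
    (hϖmax : ∀ t : M, ρ t = t → Valued.v t < 1 → Valued.v t ≤ Valued.v (jE ϖ))
    (φ : (Fin 2 → E) →+ M) (hφs : ∀ (c : E) (x : Fin 2 → E), φ (c • x) = jE c * φ x) (hφi : Function.Injective φ) (hφo : Function.Surjective φ)
    {γ₂ : GL (Fin 2) E} {lam h : M} (hφγ : ∀ x, φ ((γ₂ : Matrix (Fin 2) (Fin 2) E).mulVec x) = lam * φ x) (hlam : Valued.v lam = 1)
    (hΘh : Θ h = h) (hh : h ≠ 0) (hform : ∀ x y, jE (pairing σ H₂ x y) = h * Θ (φ x) * φ y + ρ (h * Θ (φ x) * φ y))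
    (u : GL (Fin 1) E) (hΓ : endoGL (γ₂, u) ∈ unitaryGroupOfForm σ (!![H₂ 0 0, 0, H₂ 0 1; 0, hW, 0; H₂ 1 0, 0, H₂ 1 1] : Matrix (Fin 3) (Fin 3) E))
    (hu : Valued.v ((u : Matrix (Fin 1) (Fin 1) E) 0 0) = 1)
    {X : Matrix (Fin 3) (Fin 3) E} (hcol : ∀ l, l ≠ 1 → X l 1 = 0) (hrow : ∀ l, l ≠ 1 → X 1 l = 0)
    {ξ : M} (hξ : ∀ y, φ ((!![X 0 0, X 0 2; X 2 0, X 2 2] : Matrix (Fin 2) (Fin 2) E) *ᵥ y) = ξ * φ y)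
    {c : E} (hc : c ≠ 0) (hXc : Valued.v (X 1 1) ≤ Valued.v c) {R : ℕ}
    (hfinF : {L : Submodule 𝒪[E] (Fin 3 → E) |
      IsSelfDualLattice σ ϖ (!![H₂ 0 0, 0, H₂ 0 1; 0, hW, 0; H₂ 1 0, 0, H₂ 1 1] : Matrix (Fin 3) (Fin 3) E) L ∧ mapGL (endoGL (γ₂, u)) L = L}.Finite)
    (hR : ∀ L : Submodule 𝒪[E] (Fin 3 → E), IsSelfDualLattice σ ϖ (!![H₂ 0 0, 0, H₂ 0 1; 0, hW, 0; H₂ 1 0, 0, H₂ 1 1] : Matrix (Fin 3) (Fin 3) E) L →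
      mapGL (endoGL (γ₂, u)) L = L → ∀ b : ℕ, (∀ c : E, (Pi.single 1 c : Fin 3 → E) ∈ L ↔ Valued.v c ≤ Valued.v ϖ ^ b) → b ≤ R)
    {J : ℕ} (hJ : ¬ IsOrd ρ α (jE ϖ ^ (J + 1)) lam) (hfinLS : ∀ j a, (levelSet ρ Θ α (jE ϖ) h j a).Finite)
    (f : ℕ → ℕ → AddSubgroup M → ℕ)
    (hf : ∀ (b j : ℕ) (Λ : AddSubgroup M) (x₀ : M) (r : E), 1 ≤ b → x₀ ≠ 0 →
      (∀ x, x ∈ Λ ↔ ∃ z, IsOrd ρ α (jE ϖ ^ j) z ∧ x = x₀ * z) →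
      IsOrd ρ α (jE ϖ ^ j) (dualGen ρ Θ α (jE ϖ ^ j) h x₀) → ¬ IsOrd ρ α (jE ϖ ^ j) (dualGen ρ Θ α (jE ϖ ^ j) h x₀ / jE ϖ) →
      Valued.v (dualGen ρ Θ α (jE ϖ ^ j) h x₀) = Valued.v (jE ϖ) ^ b →
      (∀ b', (∀ x ∈ Λ, Valued.v (h * Θ x * b' + ρ (h * Θ x * b')) ≤ 1) → (lam - jE ((u : Matrix (Fin 1) (Fin 1) E) 0 0)) * b' ∈ Λ) →
      IsOrd ρ α (jE ϖ ^ j) lam → jE r = glueUnit ρ Θ α (jE ϖ ^ j) h (jE ϖ) (jE hW) x₀ b →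
      f b j Λ = Nat.card {x : 𝒪[E] ⧸ 𝓂[E] ^ (2 * b) // ∃ u' : 𝒪[E], Ideal.Quotient.mk (𝓂[E] ^ (2 * b)) u' = x ∧
        Valued.v ((u' : E) * σ u' - r) ≤ Valued.v (ϖ ^ (2 * b))}) :
    {L : Submodule 𝒪[E] (Fin 3 → E) |
        IsSelfDualLattice σ ϖ (!![H₂ 0 0, 0, H₂ 0 1; 0, hW, 0; H₂ 1 0, 0, H₂ 1 1] : Matrix (Fin 3) (Fin 3) E) L ∧ mapGL (endoGL (γ₂, u)) L = L ∧
          L.map ((Matrix.toLin' X).restrictScalars 𝒪[E]) ≤ scaleLattice c L}.ncard =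
      (∑ j ∈ Finset.range (J + 1), (if IsOrd ρ α (jE ϖ ^ j) lam ∧ IsOrd ρ α (jE ϖ ^ j) ((jE c)⁻¹ * ξ) then (levelSet ρ Θ α (jE ϖ) h j 0).ncard else 0)) +
        ∑ b ∈ Finset.Icc 1 R, ∑ j ∈ Finset.range (J + 1), (if IsOrd ρ α (jE ϖ ^ j) lam ∧ IsOrd ρ α (jE ϖ ^ j) ((jE c)⁻¹ * ξ) then
          ∑ᶠ Λ ∈ levelSetDep ρ Θ α (jE ϖ) h j b (lam - jE ((u : Matrix (Fin 1) (Fin 1) E) 0 0)) ∩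
            levelSetDep ρ Θ α (jE ϖ) h j b ((jE c)⁻¹ * (ξ - jE (X 1 1))), f b j Λ else 0) := by
  rw [ncard_fixed_selfDual_endoGL_token_eq_axis_add_sum σ hσ hvσ hϖ hH₂ hH₂σ hhW γ₂ u hΓ hu hcol hrow hc hXc hfinF hR]
  congr 1
  · have hset : {B₂ : Submodule 𝒪[E] (Fin 2 → E) | IsSelfDualLattice σ ϖ H₂ B₂ ∧ mapGL γ₂ B₂ = B₂ ∧
          B₂.map ((Matrix.toLin' (!![X 0 0, X 0 2; X 2 0, X 2 2] : Matrix (Fin 2) (Fin 2) E)).restrictScalars 𝒪[E]) ≤ scaleLattice c B₂} =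
        {B : Submodule 𝒪[E] (Fin 2 → E) | IsSelfDualLattice σ ϖ H₂ B ∧ mapGL γ₂ B = B ∧
          ∀ y ∈ B, c⁻¹ • ((!![X 0 0, X 0 2; X 2 0, X 2 2] : Matrix (Fin 2) (Fin 2) E) *ᵥ y) ∈ B} := by
      ext B
      simp only [Set.mem_setOf_eq, map_toLin'_le_scaleLattice_iff_forall_mulVec_mem₂, mem_scaleLattice_iff hc]
    rw [hset]
    exact ncard_selfDual_fixed_token_plane_eq_sum_levelSet_zero σ hvσ hϖ hH₂ jE hρρ hvρ hα hα1 hint hΘΘ hΘρ hvΘ hjv hjfix hjpow hEval φ hφs hφi hφo hφγ hlam hh hform hJ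
      (fun j => hfinLS j 0) hξ c
  · refine Finset.sum_congr rfl fun b hb => ?_
    exact finsum_ncard_glueFibre_token_eq_sum_levelSetDep_inter σ hσ hvσ hϖ hH₂ hH₂σ hhW hhWσ jE hρρ hvρ hα hα1 hint hΘΘ hΘρ hvΘ hΘj hjv hjfix hjpow hEval hϖmax φ hφs
      hφi hφo hφγ hlam hΘh hh hform ((u : Matrix (Fin 1) (Fin 1) E) 0 0) hu.le hξ hc hXc (Finset.mem_Icc.1 hb).1 hJ (fun j _ => hfinLS j b) f hf

end Summit.HodgeConjecture.HodgeConjecture.Cruxes.H413.F0P3cDyRamBlockCensusOrderFormToken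

end
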